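import Mathlib.Algebra.BigOperators.Fin
import Mathlib.Algebra.BigOperators.Pi
import Mathlib.Algebra.Order.BigOperators.Ring.Finset
import Mathlib.Algebra.Order.Ring.Defs
import Mathlib.Data.Fintype.Pi
import Mathlib.Tactic

/-!
# Griffiths' first inequality on a finite spin system (blind cell PercRepro2, typer-1; mine-1 g9
`proofs/MINE1-IID-UNION.md` §2 — the inner sum of the core-free (PU)/(PART) theorem; lead g11
ASSIGNMENTS v11.11 "the Griffiths theorem (core-free (PU)) → typer-1's queue after PA-sub")

Spins `σ ∈ {±1}^ι` (encoded as `ι → Bool`, `spin true = 1`, `spin false = −1`), a monomial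
`σ^a = Π_k σ_k^{a_k}` and a ferromagnetic pair interaction `Π_{(i,j,α,β) ∈ L} (α + β σ_i σ_j)` with
`α, β ≥ 0`:

**`griffiths_one`**: `0 ≤ Σ_σ σ^a · Π_{(i,j,α,β) ∈ L} (α + β σ_i σ_j)`.

Proof by induction on the interaction list: with no interaction `Σ_σ σ^a = Π_k (1 + (−1)^{a_k}) ≥ 0`
(`sum_spinPow`); adding a pair `(α + β σ_i σ_j)` splits the sum into `α` times the same sum and `β` times
the sum with the monomial `σ^{a + e_i + e_j}` (`spinPow_add_single`), both `≥ 0` by the induction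
hypothesis. This is mine-1's "every term is a non-negative coefficient times `Σ_σ σ_A Π_F σ_iσ_j ∈ {0, 2^r}`".
-/

namespace Summit.Ventures.PercRepro2

namespace Griffiths

variable {R : Type*} [CommRing R] [LinearOrder R] [IsStrictOrderedRing R]

/-- The spin value of a Boolean: `true ↦ 1`, `false ↦ −1`. -/
def spin (x : Bool) : R := if x then 1 else -1

omit [LinearOrder R] [IsStrictOrderedRing R] in
/-- `σ² = 1`. -/
lemma spin_sq (x : Bool) : (spin x : R) ^ 2 = 1 := by
  cases x <;> simp [spin]

omit [LinearOrder R] [IsStrictOrderedRing R] in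
/-- `σ · σ = 1`. -/
lemma spin_mul_self (x : Bool) : (spin x : R) * spin x = 1 := by
  cases x <;> simp [spin]

/-- `Σ_{x ∈ {±1}} x^n = 1 + (−1)^n ≥ 0`. -/
lemma sum_spin_pow_nonneg (n : ℕ) : (0 : R) ≤ ∑ x : Bool, (spin x : R) ^ n := by
  rw [Fintype.sum_bool]
  have h1 : (spin true : R) = 1 := rfl
  have h0 : (spin false : R) = -1 := rfl
  rw [h1, h0, one_pow]
  rcases Nat.even_or_odd n with h | h
  · rw [h.neg_one_pow]; norm_num
  · rw [h.neg_one_pow]; norm_num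

variable {ι : Type*} [Fintype ι] [DecidableEq ι]

/-- The monomial `σ^a = Π_k σ_k^{a_k}`. -/
def spinPow (a : ι → ℕ) (b : ι → Bool) : R := ∏ k, (spin (b k) : R) ^ a k

/-- The free sum of a monomial factorises over the sites: `Σ_σ σ^a = Π_k (1 + (−1)^{a_k}) ≥ 0`. -/
lemma sum_spinPow_nonneg (a : ι → ℕ) : (0 : R) ≤ ∑ b : ι → Bool, spinPow a b := by
  unfold spinPow
  have := Fintype.prod_sum (fun k (x : Bool) => (spin x : R) ^ a k)
  rw [← this]
  exact Finset.prod_nonneg fun k _ => sum_spin_pow_nonneg (a k)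

omit [LinearOrder R] [IsStrictOrderedRing R] in
/-- Multiplying the monomial by `σ_i` raises the exponent at `i`. -/
lemma spinPow_mul_spin (a : ι → ℕ) (i : ι) (b : ι → Bool) :
    spinPow a b * (spin (b i) : R) = spinPow (a + Pi.single i 1) b := by
  unfold spinPow
  have : (∏ k, (spin (b k) : R) ^ (a + Pi.single i 1 : ι → ℕ) k) =
      (∏ k, (spin (b k) : R) ^ a k) * ∏ k, (spin (b k) : R) ^ (Pi.single i 1 : ι → ℕ) k := by
    rw [← Finset.prod_mul_distrib]
    refine Finset.prod_congr rfl fun k _ => ?_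
    rw [Pi.add_apply, pow_add]
  rw [this]
  congr 1
  rw [Finset.prod_eq_single i]
  · simp
  · intro k _ hk
    rw [Pi.single_eq_of_ne hk, pow_zero]
  · intro h
    exact absurd (Finset.mem_univ i) h

/-- **Griffiths' first inequality**: for `α, β ≥ 0`,
`0 ≤ Σ_σ σ^a · Π_{(i,j,α,β) ∈ L} (α + β σ_i σ_j)`. -/
theorem griffiths_one (a : ι → ℕ) (L : List (ι × ι × R × R))
    (hL : ∀ t ∈ L, 0 ≤ t.2.2.1 ∧ 0 ≤ t.2.2.2) :
    (0 : R) ≤ ∑ b : ι → Bool, spinPow a b *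
      (L.map fun t => t.2.2.1 + t.2.2.2 * spin (b t.1) * spin (b t.2.1)).prod := by
  induction L generalizing a with
  | nil =>
    simp only [List.map_nil, List.prod_nil, mul_one]
    exact sum_spinPow_nonneg a
  | cons t L ih =>
    obtain ⟨i, j, α, β⟩ := t
    have hα : 0 ≤ α := (hL _ (List.mem_cons_self)).1
    have hβ : 0 ≤ β := (hL _ (List.mem_cons_self)).2
    have hL' : ∀ t ∈ L, 0 ≤ t.2.2.1 ∧ 0 ≤ t.2.2.2 := fun t ht => hL t (List.mem_cons_of_mem _ ht)
    simp only [List.map_cons, List.prod_cons]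
    have hsplit : ∀ b : ι → Bool, spinPow a b *
        ((α + β * spin (b i) * spin (b j)) *
          (L.map fun t => t.2.2.1 + t.2.2.2 * spin (b t.1) * spin (b t.2.1)).prod) =
        α * (spinPow a b * (L.map fun t => t.2.2.1 + t.2.2.2 * spin (b t.1) * spin (b t.2.1)).prod) +
        β * (spinPow (a + Pi.single i 1 + Pi.single j 1) b *
          (L.map fun t => t.2.2.1 + t.2.2.2 * spin (b t.1) * spin (b t.2.1)).prod) := by
      intro b
      rw [← spinPow_mul_spin, ← spinPow_mul_spin]
      ring
    simp_rw [hsplit]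
    rw [Finset.sum_add_distrib, ← Finset.mul_sum, ← Finset.mul_sum]
    exact add_nonneg (mul_nonneg hα (ih a hL')) (mul_nonneg hβ (ih _ hL'))

end Griffiths

end Summit.Ventures.PercRepro2
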